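import Mathlib
import Summits.NavierStokesRegularity.NavierStokesRegularity.Theorems.EulerZoomLiouvillePowerGaugeEulerLiouvilleSelfSimilarSwirlBudgetFaces
import Summits.NavierStokesRegularity.NavierStokesRegularity.Theorems.EulerZoomLiouvillePowerGaugeEulerLiouvilleNeedleSlices
import Summits.NavierStokesRegularity.NavierStokesRegularity.Theorems.SwirlThresholdSwirlSupStrictDecreaseStrong
import HarnessLib

/-!
# Crux E `PowerGaugeEulerLiouville` (stmt-NavierStokesRegularity-19832), THE ONE STATEMENT `stub_selfSimilarC2Needle`, target T1:
# «THE AXISYMMETRIC NEEDLE HAS NO SWIRL» (4/5) — quiet planes / quiet cylinders by Chebyshev, and THE BOUND OF ONE SCALE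
# (width seat ns-ezl-w3 g4; target T1 of LEAD ns-typeII-p2's RESIDUE-MEMO-19832 §2)

Route №10 `EulerZoomLiouville` (NavierStokesRegularity), crux E; LEAD ns-typeII-p2 g12.

* `measurable_planeIntegral`, `measurable_cylIntegral`, **`exists_quiet_plane`**, **`exists_quiet_cylinder`** — Chebyshev in the height window `(a, b)` / in the
  radius window `(L, 2L)` for two measurable densities at once (`NeedleThinness.exists_good_slice` through `lintegral_eq_lintegral_cartesian` /
  `lintegral_eq_lintegral_cylindrical_radial` of the tools file): truncated plane integrals `< 4Xᵢ/(b−a)`, truncated cylinder integrals `≤ 4Xᵢ/(L R)`.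
* **`abs_swirl_le_of_scale`** — ONE SCALE: `(U, P)` a `C²` self-similar Euler profile (CIV (3.3)), `U` axisymmetric, `0 < γ < ½`, `L ≥ 1`, ball budgets
  `∫⁻_{B(0,6L)} ‖U‖² ≤ X_A`, `∫⁻_{B(0,6L)} ‖DU‖² ≤ X_E` and the largeness condition `4X_A/L² + 36 L X_E ≤ πγ²L³` ⇒ `|Γ(y)| ≤ X_A/(γL³) + 3X_E/(γL)` on `‖y‖ ≤ L`.
  Proof: quiet radius `R ∈ (L, 2L)` and quiet heights `H₂ ∈ (2L, 4L)`, `H₁ ∈ (−4L, −2L)`; the maximum of `Γ²` over the solid cylinder `K = {r ≤ R, H₁ ≤ z ≤ H₂} ⊇ B̄_L`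
  sits at a strict-inflow boundary point `a` (`swirlMax_cylinder_trichotomy`), WLOG `a = (r_a, 0, z_a)`; LATERAL contradicts largeness
  (`lateral_face_estimate`: `πγ²L³ < πL‖U a‖² ≤ 4X_A/L² + 36 L X_E`); TOP/BOTTOM give `‖U a‖ > 2γL` and (`top_face_estimate`) `r_a L ‖U a‖² ≤ 2X_A/L + 6 L X_E`,
  whence `|Γ(y)| ≤ |Γ(a)| ≤ r_a ‖U a‖ ≤ X_A/(γL³) + 3X_E/(γL)`.

The theorem (`hasNoSwirl_of_budgets`: `L → ∞`) and the member form follow in `…SelfSimilarSwirlBudget`.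
WHAT THIS IS NOT: not NS regularity, not the crux E — a portrait stratum of THE ONE STATEMENT of
the crux CLASS 19832 (MODEL lattice; E/NS strata), `--supports` stmt-19832; every NON-axisymmetric `C²` needle stays OPEN; 19832 OPEN.
[cite: Chae2007CMPEuler, Thm 2.2 + Note added p. 6; ConstantinIgnatovaVicol2026Putative, §4.4 proof of Thm 4.6; CaffarelliKohnNirenberg1982, §2]
-/

noncomputable section

-- flat `Theorems/<Route><Decl>…` files of one crux share the namespace of the crux (tree convention: `Summit.<S>.<S>.…`)
set_option linter.dupNamespace false

open MeasureTheory Set Filter Topology Metric Function InnerProductSpace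
open scoped RealInnerProductSpace NNReal ENNReal ContDiff

namespace Summit.NavierStokesRegularity.NavierStokesRegularity.Theorems.PowerGaugeEulerLiouville

namespace SwirlBudget

open Literature.Analysis Literature.Analysis.FluidPDE Literature.Analysis.FunctionSpaces

variable {γ : ℝ} {U : EuclideanSpace ℝ (Fin 3) → EuclideanSpace ℝ (Fin 3)} {P : EuclideanSpace ℝ (Fin 3) → ℝ}

/-! ### Quiet planes and quiet cylinders (Chebyshev in the height / in the radius) -/

/-- The truncated plane integral `H ↦ ∫⁻_t ∫⁻_s G(s, t, H)` of a measurable `G ≥ 0` is measurable in the height. [folklore (Tonelli)] -/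
theorem measurable_planeIntegral {G : EuclideanSpace ℝ (Fin 3) → ℝ≥0∞} (hG : Measurable G) :
    Measurable fun H : ℝ => ∫⁻ t : ℝ, ∫⁻ s : ℝ, G (WithLp.toLp 2 ![s, t, H]) := by
  have h3 : Measurable fun p : (ℝ × ℝ) × ℝ => G (WithLp.toLp 2 ![p.2, p.1.2, p.1.1]) :=
    hG.comp (continuous_cartesianPt.comp (continuous_snd.prodMk
      ((continuous_snd.comp continuous_fst).prodMk (continuous_fst.comp continuous_fst)))).measurable
  have h2 : Measurable fun p : ℝ × ℝ => ∫⁻ s : ℝ, G (WithLp.toLp 2 ![s, p.2, p.1]) := h3.lintegral_prod_right'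
  exact h2.lintegral_prod_right'

/-- The weighted truncated cylinder integral `ρ ↦ ρ ∫⁻_{θ∈(−π,π)} ∫⁻_z G(ρ cos θ, ρ sin θ, z)` is measurable in the radius. [folklore (Tonelli)] -/
theorem measurable_cylIntegral {G : EuclideanSpace ℝ (Fin 3) → ℝ≥0∞} (hG : Measurable G) :
    Measurable fun ρ : ℝ => ENNReal.ofReal ρ * ∫⁻ θ in Ioo (-Real.pi) Real.pi, ∫⁻ z : ℝ,
      G (WithLp.toLp 2 ![ρ * Real.cos θ, ρ * Real.sin θ, z]) := by
  have h3 : Measurable fun p : (ℝ × ℝ) × ℝ =>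
      G (WithLp.toLp 2 ![p.1.1 * Real.cos p.1.2, p.1.1 * Real.sin p.1.2, p.2]) :=
    hG.comp (continuous_cylindricalPt.comp ((continuous_fst.comp continuous_fst).prodMk
      ((continuous_snd.comp continuous_fst).prodMk continuous_snd))).measurable
  have h2 : Measurable fun p : ℝ × ℝ => ∫⁻ z : ℝ, G (WithLp.toLp 2 ![p.1 * Real.cos p.2, p.1 * Real.sin p.2, z]) :=
    h3.lintegral_prod_right'
  exact ENNReal.measurable_ofReal.mul h2.lintegral_prod_right'

/-- **A QUIET PLANE** in the height window `(a, b)`: for two measurable densities `G₁, G₂ ≥ 0` on `E³` with `∫⁻ Gᵢ ≤ Xᵢ` (`0 < Xᵢ`), some height `H ∈ (a, b)`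
has both plane integrals `∫⁻_t ∫⁻_s Gᵢ(s,t,H) < 4Xᵢ/(b−a)`. [folklore (Chebyshev + Tonelli)] -/
theorem exists_quiet_plane {G₁ G₂ : EuclideanSpace ℝ (Fin 3) → ℝ≥0∞} (hG₁ : Measurable G₁) (hG₂ : Measurable G₂)
    {a b X₁ X₂ : ℝ} (hab : a < b) (hX₁ : 0 < X₁) (hX₂ : 0 < X₂)
    (h₁ : ∫⁻ x, G₁ x ≤ ENNReal.ofReal X₁) (h₂ : ∫⁻ x, G₂ x ≤ ENNReal.ofReal X₂) :
    ∃ H ∈ Ioo a b, (∫⁻ t : ℝ, ∫⁻ s : ℝ, G₁ (WithLp.toLp 2 ![s, t, H])) < ENNReal.ofReal (4 * X₁ / (b - a)) ∧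
      (∫⁻ t : ℝ, ∫⁻ s : ℝ, G₂ (WithLp.toLp 2 ![s, t, H])) < ENNReal.ofReal (4 * X₂ / (b - a)) := by
  refine NeedleThinness.exists_good_slice (measurable_planeIntegral hG₁) (measurable_planeIntegral hG₂) hab hX₁ hX₂ ?_ ?_
  · exact ((setLIntegral_le_lintegral _ _).trans (le_of_eq (lintegral_eq_lintegral_cartesian hG₁).symm)).trans h₁
  · exact ((setLIntegral_le_lintegral _ _).trans (le_of_eq (lintegral_eq_lintegral_cartesian hG₂).symm)).trans h₂

/-- **A QUIET CYLINDER** in the radius window `(L, 2L)`, `0 < L`: for two measurable densities with `∫⁻ Gᵢ ≤ Xᵢ` (`0 < Xᵢ`), some radius `R ∈ (L, 2L)` has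
both cylinder integrals `∫⁻_{θ∈(−π,π)} ∫⁻_z Gᵢ(R cos θ, R sin θ, z) ≤ 4Xᵢ/(L R)`. [folklore (Chebyshev + cylindrical Tonelli)] -/
theorem exists_quiet_cylinder {G₁ G₂ : EuclideanSpace ℝ (Fin 3) → ℝ≥0∞} (hG₁ : Measurable G₁) (hG₂ : Measurable G₂)
    {L X₁ X₂ : ℝ} (hL : 0 < L) (hX₁ : 0 < X₁) (hX₂ : 0 < X₂)
    (h₁ : ∫⁻ x, G₁ x ≤ ENNReal.ofReal X₁) (h₂ : ∫⁻ x, G₂ x ≤ ENNReal.ofReal X₂) :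
    ∃ R ∈ Ioo L (2 * L),
      (∫⁻ θ in Ioo (-Real.pi) Real.pi, ∫⁻ z : ℝ, G₁ (WithLp.toLp 2 ![R * Real.cos θ, R * Real.sin θ, z])) ≤
          ENNReal.ofReal (4 * X₁ / (L * R)) ∧
        (∫⁻ θ in Ioo (-Real.pi) Real.pi, ∫⁻ z : ℝ, G₂ (WithLp.toLp 2 ![R * Real.cos θ, R * Real.sin θ, z])) ≤
          ENNReal.ofReal (4 * X₂ / (L * R)) := by
  have hLL : L < 2 * L := by linarith
  have hsub : Ioo L (2 * L) ⊆ Ioi 0 := fun ρ hρ => hL.trans hρ.1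
  have hI : ∀ {G : EuclideanSpace ℝ (Fin 3) → ℝ≥0∞}, Measurable G → ∀ {X : ℝ}, ∫⁻ x, G x ≤ ENNReal.ofReal X →
      ∫⁻ ρ in Ioo L (2 * L), ENNReal.ofReal ρ * ∫⁻ θ in Ioo (-Real.pi) Real.pi, ∫⁻ z : ℝ,
        G (WithLp.toLp 2 ![ρ * Real.cos θ, ρ * Real.sin θ, z]) ≤ ENNReal.ofReal X := by
    intro G hG X hX
    exact ((lintegral_mono_set hsub).trans (le_of_eq (lintegral_eq_lintegral_cylindrical_radial hG).symm)).trans hX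
  obtain ⟨R, hR, hR₁, hR₂⟩ := NeedleThinness.exists_good_slice (measurable_cylIntegral hG₁) (measurable_cylIntegral hG₂)
    hLL hX₁ hX₂ (hI hG₁ h₁) (hI hG₂ h₂)
  have hR0 : 0 < R := hL.trans hR.1
  have hbm : (2 * L - L) = L := by ring
  rw [hbm] at hR₁ hR₂
  -- divide by `R`
  have hdiv : ∀ {Φ : ℝ≥0∞} {X : ℝ}, ENNReal.ofReal R * Φ < ENNReal.ofReal (4 * X / L) → Φ ≤ ENNReal.ofReal (4 * X / (L * R)) := by
    intro Φ X hlt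
    have hR' : ENNReal.ofReal R ≠ 0 := (ENNReal.ofReal_pos.2 hR0).ne'
    have h1 : Φ ≤ ENNReal.ofReal (4 * X / L) / ENNReal.ofReal R := by
      rw [ENNReal.le_div_iff_mul_le (Or.inl hR') (Or.inl ENNReal.ofReal_ne_top), mul_comm]
      exact hlt.le
    rwa [← ENNReal.ofReal_div_of_pos hR0, div_div] at h1
  exact ⟨R, hR, hdiv hR₁, hdiv hR₂⟩

/-! ### One scale -/

/-- The closed ball `‖x‖ ≤ L` lies in the solid cylinder `{r ≤ R, H₁ ≤ z ≤ H₂}` once `L ≤ R`, `H₁ ≤ −L`, `L ≤ H₂`. [folklore] -/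
theorem mem_cylinderSet_of_norm_le {L R H₁ H₂ : ℝ} (hR : L ≤ R) (hH₁ : H₁ ≤ -L) (hH₂ : L ≤ H₂) {x : EuclideanSpace ℝ (Fin 3)}
    (hx : ‖x‖ ≤ L) : x ∈ {y : EuclideanSpace ℝ (Fin 3) | cylRadius y ≤ R ∧ y 2 ∈ Icc H₁ H₂} := by
  have h2 : |x 2| ≤ ‖x‖ := by have := PiLp.norm_apply_le x 2; rwa [Real.norm_eq_abs] at this
  have hn : ‖x‖ ^ 2 = cylRadius x ^ 2 + x 2 ^ 2 := by
    rw [EuclideanSpace.real_norm_sq_eq, Fin.sum_univ_three, cylRadius_sq]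
  have hr : cylRadius x ≤ ‖x‖ := by nlinarith [cylRadius_nonneg x, norm_nonneg x, sq_nonneg (x 2)]
  exact ⟨by linarith, by linarith [(abs_le.1 h2).1], by linarith [(abs_le.1 h2).2]⟩

/-- Solid cylinders `{r ≤ R, H₁ ≤ z ≤ H₂}` are compact. [folklore] -/
theorem isCompact_cylinderSet (R H₁ H₂ : ℝ) : IsCompact {y : EuclideanSpace ℝ (Fin 3) | cylRadius y ≤ R ∧ y 2 ∈ Icc H₁ H₂} := by
  have h2c : Continuous fun x : EuclideanSpace ℝ (Fin 3) => x 2 := by fun_prop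
  refine Metric.isCompact_of_isClosed_isBounded
    ((isClosed_le continuous_cylRadius continuous_const).inter (isClosed_Icc.preimage h2c)) ?_
  refine (isBounded_closedBall (x := (0 : EuclideanSpace ℝ (Fin 3))) (r := |R| + (|H₁| + |H₂|))).subset fun x hx => ?_
  rw [mem_closedBall, dist_zero_right]
  have hn : ‖x‖ ^ 2 = cylRadius x ^ 2 + x 2 ^ 2 := by
    rw [EuclideanSpace.real_norm_sq_eq, Fin.sum_univ_three, cylRadius_sq]
  have hz : |x 2| ≤ |H₁| + |H₂| := by
    rw [abs_le]; constructor <;> cases abs_cases H₁ <;> cases abs_cases H₂ <;> linarith [hx.2.1, hx.2.2]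
  have hr : cylRadius x ≤ |R| := hx.1.trans (le_abs_self R)
  have hr0 := cylRadius_nonneg x
  have hsq : ‖x‖ ^ 2 ≤ (|R| + (|H₁| + |H₂|)) ^ 2 := by
    rw [hn]
    nlinarith [abs_nonneg (x 2), sq_abs (x 2), abs_nonneg H₁, abs_nonneg H₂, abs_nonneg R,
      mul_le_mul hr hr hr0 (abs_nonneg R), mul_le_mul hz hz (abs_nonneg _) (by positivity)]
  exact (abs_le_of_sq_le_sq' hsq (by positivity)).2

/-- Arithmetic of the LATERAL case: `γR < u`, `πL(γR)² ≤ 4X_A/(LR) + 9L²·4X_E/(LR)`, `L < R` and the largeness `4X_A/L² + 36LX_E ≤ πγ²L³` are incompatible.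
[folklore] -/
theorem lateral_absurd {γ L R XA XE : ℝ} (hγ : 0 < γ) (hL : 1 ≤ L) (hLR : L < R) (hXA : 0 ≤ XA) (hXE : 0 ≤ XE)
    (hest : Real.pi * L * (γ * R) ^ 2 ≤ 4 * XA / (L * R) + 9 * L ^ 2 * (4 * XE / (L * R)))
    (hbig : 4 * XA / L ^ 2 + 36 * L * XE ≤ Real.pi * γ ^ 2 * L ^ 3) : False := by
  have hL0 : 0 < L := by linarith
  have hR : 0 < R := hL0.trans hLR
  have hRL : 4 * XA / (L * R) ≤ 4 * XA / L ^ 2 :=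
    div_le_div_of_nonneg_left (by positivity) (by positivity) (by nlinarith)
  have h36 : 9 * L ^ 2 * (4 * XE / (L * R)) ≤ 36 * L * XE := by
    have h1 : 4 * XE / (L * R) ≤ 4 * XE / (L * L) :=
      div_le_div_of_nonneg_left (by positivity) (by positivity) (by nlinarith)
    have h2 : 9 * L ^ 2 * (4 * XE / (L * L)) = 36 * XE := by
      field_simp
      ring
    have h3 : 36 * XE ≤ 36 * L * XE := by nlinarith
    nlinarith [mul_le_mul_of_nonneg_left h1 (by positivity : (0 : ℝ) ≤ 9 * L ^ 2)]
  have h1 : Real.pi * L * (γ * R) ^ 2 ≤ Real.pi * γ ^ 2 * L ^ 3 := by linarith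
  have h2 : L ^ 2 < R ^ 2 := by nlinarith
  have h3 : Real.pi * γ ^ 2 * L ^ 3 < Real.pi * L * (γ * R) ^ 2 := by
    have : Real.pi * L * (γ * R) ^ 2 - Real.pi * γ ^ 2 * L ^ 3 = Real.pi * γ ^ 2 * L * (R ^ 2 - L ^ 2) := by ring
    have hpos : 0 < Real.pi * γ ^ 2 * L * (R ^ 2 - L ^ 2) := by
      have := Real.pi_pos; positivity
    linarith
  linarith

/-- Arithmetic of the TOP/BOTTOM case: `2γL < u`, `0 ≤ r`, `rLu² ≤ 4X_A/(2L) + 3L²·4X_E/(2L)` give `r·u ≤ X_A/(γL³) + 3X_E/(γL)`. [folklore] -/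
theorem top_arith {γ L r u XA XE : ℝ} (hγ : 0 < γ) (hL : 0 < L) (hr : 0 ≤ r) (hu : 2 * γ * L < u)
    (hest : r * L * u ^ 2 ≤ 4 * XA / (2 * L) + 3 * L ^ 2 * (4 * XE / (2 * L))) :
    r * u ≤ XA / (γ * L ^ 3) + 3 * XE / (γ * L) := by
  have e : 4 * XA / (2 * L) + 3 * L ^ 2 * (4 * XE / (2 * L)) = 2 * XA / L + 6 * L * XE := by
    field_simp; ring
  rw [e] at hest
  have hu0 : 0 < u := by nlinarith
  have hM : r * u * (L * u) ≤ 2 * XA / L + 6 * L * XE := by nlinarith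
  have hLu : 2 * γ * L ^ 2 ≤ L * u := by nlinarith
  have h3 : r * u * (2 * γ * L ^ 2) ≤ 2 * XA / L + 6 * L * XE :=
    (mul_le_mul_of_nonneg_left hLu (mul_nonneg hr hu0.le)).trans hM
  rw [show XA / (γ * L ^ 3) + 3 * XE / (γ * L) = (2 * XA / L + 6 * L * XE) / (2 * γ * L ^ 2) by field_simp; ring,
    le_div_iff₀ (by positivity)]
  exact h3

/-- **ONE SCALE.**  `(U, P)` a `C²` self-similar Euler profile (CIV (3.3)), `U` axisymmetric, `0 < γ < ½`; `L ≥ 1`; budgets on the ball `B(0, 6L)`: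
`∫⁻ ‖U‖² ≤ X_A`, `∫⁻ ‖DU‖² ≤ X_E` (`0 < X_A, X_E`), and the scale is LARGE in the sense `4X_A/L² + 36 L X_E ≤ π γ² L³` (which kills the lateral case).  Then
`|Γ(y)| ≤ X_A/(γL³) + 3X_E/(γL)` for every `y` with `‖y‖ ≤ L`. [cite: Chae2007CMPEuler, Thm 2.2 + Note added p. 6] -/
theorem abs_swirl_le_of_scale (h : IsSelfSimilarEulerProfile γ 0 U P) (hU : IsAxisymmetric U) (hγ0 : 0 < γ) (hγ2 : γ < 1 / 2)
    {L XA XE : ℝ} (hL : 1 ≤ L) (hXA : 0 < XA) (hXE : 0 < XE)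
    (hA : ∫⁻ y in ball (0 : EuclideanSpace ℝ (Fin 3)) (6 * L), ‖U y‖ₑ ^ 2 ≤ ENNReal.ofReal XA)
    (hE : ∫⁻ y in ball (0 : EuclideanSpace ℝ (Fin 3)) (6 * L), ‖fderiv ℝ U y‖ₑ ^ 2 ≤ ENNReal.ofReal XE)
    (hbig : 4 * XA / L ^ 2 + 36 * L * XE ≤ Real.pi * γ ^ 2 * L ^ 3)
    {y : EuclideanSpace ℝ (Fin 3)} (hy : ‖y‖ ≤ L) :
    |swirl U y| ≤ XA / (γ * L ^ 3) + 3 * XE / (γ * L) := by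
  have hL0 : 0 < L := by linarith
  have hU1 : ContDiff ℝ 1 U := h.contDiff_velocity.of_le (by norm_num)
  have hUc : Continuous U := hU1.continuous
  have hDUc : Continuous (fderiv ℝ U) := hU1.continuous_fderiv one_ne_zero
  have hΓc : Continuous (swirl U) := (contDiff_swirl h.contDiff_velocity).continuous
  -- the truncated densities
  set GA : EuclideanSpace ℝ (Fin 3) → ℝ≥0∞ := (ball (0 : EuclideanSpace ℝ (Fin 3)) (6 * L)).indicator fun y => ‖U y‖ₑ ^ 2 with hGA
  set GE : EuclideanSpace ℝ (Fin 3) → ℝ≥0∞ := (ball (0 : EuclideanSpace ℝ (Fin 3)) (6 * L)).indicator fun y => ‖fderiv ℝ U y‖ₑ ^ 2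
    with hGE
  have hGAm : Measurable GA := (hUc.measurable.enorm.pow_const 2).indicator measurableSet_ball
  have hGEm : Measurable GE := (hDUc.measurable.enorm.pow_const 2).indicator measurableSet_ball
  have hGAI : ∫⁻ x, GA x ≤ ENNReal.ofReal XA := by rw [hGA, lintegral_indicator measurableSet_ball]; exact hA
  have hGEI : ∫⁻ x, GE x ≤ ENNReal.ofReal XE := by rw [hGE, lintegral_indicator measurableSet_ball]; exact hE
  -- quiet radius and quiet heights
  obtain ⟨R, hR, hRA, hRE⟩ := exists_quiet_cylinder hGAm hGEm hL0 hXA hXE hGAI hGEI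
  obtain ⟨H₂, hH₂, hH₂A, hH₂E⟩ := exists_quiet_plane hGAm hGEm (by linarith : 2 * L < 4 * L) hXA hXE hGAI hGEI
  obtain ⟨H₁, hH₁, hH₁A, hH₁E⟩ := exists_quiet_plane hGAm hGEm (by linarith : -(4 * L) < -(2 * L)) hXA hXE hGAI hGEI
  have hR0 : 0 < R := hL0.trans hR.1
  have h4L2 : 4 * L - 2 * L = 2 * L := by ring
  have h4L1 : -(2 * L) - -(4 * L) = 2 * L := by ring
  rw [h4L2] at hH₂A hH₂E
  rw [h4L1] at hH₁A hH₁E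
  -- the solid cylinder `K = {r ≤ R, H₁ ≤ z ≤ H₂}` and the maximum of `Γ²` over it
  set K : Set (EuclideanSpace ℝ (Fin 3)) := {x | cylRadius x ≤ R ∧ x 2 ∈ Icc H₁ H₂} with hK
  have hyK : y ∈ K := mem_cylinderSet_of_norm_le hR.1.le (by linarith [hH₁.2]) (by linarith [hH₂.1]) hy
  obtain ⟨a₀, ha₀, hmax₀⟩ := (isCompact_cylinderSet R H₁ H₂).exists_isMaxOn ⟨y, hyK⟩ (hΓc.pow 2).continuousOn
  -- trivial case: the swirl vanishes on `K`
  by_cases hΓ0 : swirl U a₀ = 0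
  · have h1 : swirl U y ^ 2 ≤ swirl U a₀ ^ 2 := hmax₀ hyK
    rw [hΓ0] at h1
    have h2 : swirl U y = 0 := pow_eq_zero_iff two_ne_zero |>.1 (le_antisymm (by simpa using h1) (sq_nonneg _))
    rw [h2, abs_zero]; positivity
  -- rotate the maximum to normal form `a = (r_a, 0, z_a)`
  obtain ⟨θ₀, hθ₀⟩ := exists_rotZ_eq_normalForm a₀
  set a : EuclideanSpace ℝ (Fin 3) := rotZ θ₀ a₀ with ha_def
  have hra : cylRadius a = cylRadius a₀ := by rw [ha_def, cylRadius_rotZ]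
  have ha2 : a 2 = a₀ 2 := by rw [ha_def, rotZ_apply_two]
  have haK : a ∈ K := ⟨by rw [hra]; exact ha₀.1, by rw [ha2]; exact ha₀.2⟩
  have hΓa : swirl U a = swirl U a₀ := by rw [ha_def, swirl_apply_rotZ hU]
  have hmax : IsMaxOn (fun x => swirl U x ^ 2) K a := by
    intro x hx; have := hmax₀ hx; simp only [mem_setOf_eq] at this ⊢; rwa [hΓa]
  have hΓa0 : swirl U a ≠ 0 := by rwa [hΓa]
  have ha_nf : a = WithLp.toLp 2 ![cylRadius a, 0, a 2] := by rw [hra, ha2]; exact hθ₀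
  -- `|Γ(y)| ≤ |Γ(a)| ≤ r_a ‖U a‖`
  have hyle : |swirl U y| ≤ |swirl U a| := by
    have := hmax hyK; simp only [mem_setOf_eq] at this; exact sq_le_sq.1 this
  have hΓle : |swirl U a| ≤ cylRadius a * ‖U a‖ := SwirlSupStrictDecrease.abs_swirl_le_cylRadius_mul_norm U a
  -- the trichotomy at `a`
  have htri := swirlMax_cylinder_trichotomy h hU hγ2 hR0 (by linarith [hH₁.2]) (by linarith [hH₂.1]) haK hmax hΓa0
  rcases htri with ⟨har, hin⟩ | ⟨hat, hin⟩ | ⟨hab, hin⟩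
  · -- LATERAL: impossible at a large scale
    have hu : γ * R < ‖U a‖ := norm_gt_of_lateral hγ0.le hR0 har hin
    have hz₀ : |a 2| ≤ 4 * L := by
      rw [abs_le]; constructor <;> linarith [haK.2.1, haK.2.2, hH₁.1, hH₂.2]
    have ha_nf' : a = WithLp.toLp 2 ![R, 0, a 2] := by rw [← har]; exact ha_nf
    have hest := lateral_face_estimate hU1 hU hL0 hR0 (by linarith [hR.2]) hz₀ (by positivity : 0 < γ * R)
      (by rw [← ha_nf']; exact hu.le) (by positivity) (by positivity) hRA hRE
    exact (lateral_absurd hγ0 hL hR.1 hXA.le hXE.le hest hbig).elim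
  · -- TOP: `‖U a‖ > γH₂ > 2γL`, x-lines in the quiet plane `z = H₂`
    have hu : γ * H₂ < ‖U a‖ := norm_gt_of_top hin (by nlinarith [hH₂.1])
    have hu2 : 2 * γ * L < ‖U a‖ := lt_of_le_of_lt (by nlinarith [hH₂.1]) hu
    have hra0 : 0 < cylRadius a :=
      (cylRadius_nonneg a).lt_of_ne fun h0 => hΓa0 (swirl_eq_zero_of_cylRadius_eq_zero U h0.symm)
    have hh : |H₂| ≤ 4 * L := by rw [abs_of_nonneg (by linarith [hH₂.1])]; exact hH₂.2.le
    have ha_nf' : a = WithLp.toLp 2 ![cylRadius a, 0, H₂] := by rw [← hat]; exact ha_nf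
    have hest := top_face_estimate hU1 hU hL0 hra0 (by linarith [haK.1, hR.2]) hh (lt_trans (by positivity) hu2)
      (le_of_eq (by rw [← ha_nf'])) (by positivity) (by positivity) hH₂A.le hH₂E.le
    exact hyle.trans (hΓle.trans (top_arith hγ0 hL0 hra0.le hu2 hest))
  · -- BOTTOM: `‖U a‖ > −γH₁ > 2γL`, x-lines in the quiet plane `z = H₁`
    have hu : -(γ * H₁) < ‖U a‖ := norm_gt_of_bottom hin (by nlinarith [hH₁.2])
    have hu2 : 2 * γ * L < ‖U a‖ := lt_of_le_of_lt (by nlinarith [hH₁.2]) hu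
    have hra0 : 0 < cylRadius a :=
      (cylRadius_nonneg a).lt_of_ne fun h0 => hΓa0 (swirl_eq_zero_of_cylRadius_eq_zero U h0.symm)
    have hh : |H₁| ≤ 4 * L := by rw [abs_of_nonpos (by linarith [hH₁.2])]; linarith [hH₁.1]
    have ha_nf' : a = WithLp.toLp 2 ![cylRadius a, 0, H₁] := by rw [← hab]; exact ha_nf
    have hest := top_face_estimate hU1 hU hL0 hra0 (by linarith [haK.1, hR.2]) hh (lt_trans (by positivity) hu2)
      (le_of_eq (by rw [← ha_nf'])) (by positivity) (by positivity) hH₁A.le hH₁E.le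
    exact hyle.trans (hΓle.trans (top_arith hγ0 hL0 hra0.le hu2 hest))

end SwirlBudget

end Summit.NavierStokesRegularity.NavierStokesRegularity.Theorems.PowerGaugeEulerLiouville

end
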